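import Literature.Geometry.Kaehler.TwoFormTransgression
import Literature.Geometry.Kaehler.DDcForm
import Literature.Geometry.Kaehler.HolomorphicChainBoundary
import Mathlib.Geometry.Manifold.PartitionOfUnity
import Mathlib.Topology.MetricSpace.Thickening
import HarnessLib

/-!
# Stokes for Monge–Ampère densities on holomorphic chains: `∫ [T] ∧ χ((dd^c u)ᵖ − (dd^c v)ᵖ) = 0`

Let `T` be a holomorphic `p`-chain (`p = q + 1 > 0`) on an open subset `Ω` of a finite-dimensional
complex inner product space `V`, and let `u, v : V → ℝ` be smooth. The transgression formula
`(dd^c u)ᵖ - (dd^c v)ᵖ = d(d^c(u - v) ∧ R_q(dd^c u, dd^c v)) = dΨ`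
(`Literature/Geometry/Kaehler/TwoFormTransgression.lean`, `DDcForm.lean`) and a smooth compactly
supported cut-off `χ` with `tsupport χ ⊆ Ω` give the test form `χΨ` on `Ω` (`maTestForm`), with
`d(χΨ) = χ dΨ` at every point where `dχ = 0` or `d(u - v) = 0` (`extDeriv_maTestForm_of`); and
holomorphic chains are `d`-closed (`Harvey1977_boundary_toCurrent_eq_zero_holds`: `[T](d(χΨ)) = 0`,
with the integral formula `HolomorphicChain.boundary_apply_eq_setIntegral`). Hence

* `HolomorphicChain.setIntegral_mul_twoPow_ddcForm_sub_eq_zero` —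
  **`∫_{reg|T|} θ_T χ ((dd^c u)ᵖ − (dd^c v)ᵖ)(ξ_T) d𝓗^{2p} = 0`** whenever on the carrier `dχ = 0`
  or `d(u - v) = 0` pointwise (e.g. `χ = 1` near the part of the carrier where `u ≠ v`: balls with
  `u = v` near the sphere, or tubes of a proper projection with `u = v` off a sub-cylinder);
* `HolomorphicChain.setIntegral_twoPow_ddcForm_sub_eq_zero` — the case `d(u - v)` compactly
  supported in `Ω` (no cut-off in the statement), and the `…_eq` versions
  **`∫ θ_T (dd^c u)ᵖ(ξ_T) = ∫ θ_T (dd^c v)ᵖ(ξ_T)`** under integrability;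
* `exists_smooth_cutoff_eq_one_nhdsSet` — smooth compactly supported cut-offs equal to `1` near a
  compact subset of an open set (smooth Urysohn).

This is the integration-by-parts step "`∫_{φ<r} T ∧ (dd^c u)ᵖ = ∫_{φ<r} T ∧ (dd^c v)ᵖ` if `u = v`
near the boundary" of the theory of generalised Lelong numbers [Demailly, *Complex analytic and
differential geometry*, Ch. III (5.5)], here for currents of integration on holomorphic chains and
smooth weights [Chirka1989, §15.1 (Stokes on analytic sets, Prop. 1)]. Definitions with bodies
(`maPrimitiveFun`, `maTestForm`); theorems proved.

## References

* J.-P. Demailly, *Complex analytic and differential geometry*, Ch. III §5 (5.5).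
* E. M. Chirka, *Complex Analytic Sets*, Kluwer 1989, §14.2 Prop. 3, §15.1 [Chirka1989].
* R. Harvey, *Holomorphic chains and their boundaries* (1977), Lemma 1.8 [Harvey1977].
-/

open scoped Manifold Topology ENNReal Distributions ContDiff
open Set Filter MeasureTheory

noncomputable section

namespace Literature.Geometry.Kaehler

open Literature.Geometry.GeometricMeasureTheory TwoForm

variable {V : Type*} [NormedAddCommGroup V] [InnerProductSpace ℂ V]

/-! ### The transgression form `Ψ = d^c(u - v) ∧ R_q(dd^c u, dd^c v)` -/

/-- The `(2q+1)`-form field `Ψ(x) = d^c(u - v)(x) ∧ R_q(dd^c u(x), dd^c v(x))` (degree cast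
`1 + 2q = 2q + 1`), whose exterior derivative is `(dd^c u)^{q+1} - (dd^c v)^{q+1}`.
[cite: Chirka1989, §15.1] -/
def maPrimitiveFun (u v : V → ℝ) (q : ℕ) (x : V) : V [⋀^Fin (2 * q + 1)]→L[ℝ] ℝ :=
  TwoForm.cast (Nat.add_comm 1 (2 * q))
    ((dcForm (fun y => u y - v y) x).wedge (twoFormGeom (ddcForm u x) (ddcForm v x) q))

variable {u v : V → ℝ} {q : ℕ}

/-- Smoothness of `Ψ` for smooth `u, v`. [folklore] -/
theorem contDiff_maPrimitiveFun (hu : ContDiff ℝ ∞ u) (hv : ContDiff ℝ ∞ v) :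
    ContDiff ℝ ∞ (maPrimitiveFun u v q) := by
  unfold maPrimitiveFun
  refine contDiff_cast _ (contDiff_wedge ?_ (contDiff_twoFormGeom ?_ ?_ q))
  · exact contDiff_dcForm (hu.sub hv) (by exact_mod_cast le_top)
  · exact contDiff_ddcForm hu (le_of_eq (by norm_cast))
  · exact contDiff_ddcForm hv (le_of_eq (by norm_cast))

/-- `Ψ` vanishes where `d(u - v)` vanishes. [folklore] -/
theorem maPrimitiveFun_eq_zero {x : V} (h : fderiv ℝ (fun y => u y - v y) x = 0) :
    maPrimitiveFun u v q x = 0 := by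
  unfold maPrimitiveFun
  rw [dcForm_eq_zero_of_fderiv_eq_zero h, ContinuousAlternatingMap.zero_wedge, cast_zero]

/-- `Ψ` has compact support when `d(u - v)` does. [folklore] -/
theorem hasCompactSupport_maPrimitiveFun
    (h : HasCompactSupport (fderiv ℝ (fun y => u y - v y))) :
    HasCompactSupport (maPrimitiveFun u v q) :=
  h.mono fun x hx => by
    by_contra hx'
    exact hx (maPrimitiveFun_eq_zero (Function.notMem_support.1 hx'))

/-- **The exterior derivative of `Ψ` is `(dd^c u)^{q+1} - (dd^c v)^{q+1}`** (transgression formula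
with `θ = d^c(u-v)`, `dθ = dd^c u - dd^c v`). [cite: Chirka1989, §15.1] -/
theorem extDeriv_maPrimitiveFun (hu : ContDiff ℝ ∞ u) (hv : ContDiff ℝ ∞ v) (x : V) :
    extDeriv (maPrimitiveFun u v q) x =
      TwoForm.cast (by omega) ((ddcForm u x).twoPow (q + 1) - (ddcForm v x).twoPow (q + 1)) := by
  have huv : ContDiff ℝ ∞ (fun y => u y - v y) := hu.sub hv
  have hu3 : ContDiff ℝ 3 u := by exact_mod_cast contDiff_infty.1 hu 3
  have hv3 : ContDiff ℝ 3 v := by exact_mod_cast contDiff_infty.1 hv 3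
  have hu2 : ContDiff ℝ 2 u := by exact_mod_cast contDiff_infty.1 hu 2
  have hv2 : ContDiff ℝ 2 v := by exact_mod_cast contDiff_infty.1 hv 2
  have huv2 : ContDiff ℝ 2 (fun y => u y - v y) := by exact_mod_cast contDiff_infty.1 huv 2
  have hθ : ContDiff ℝ 1 (dcForm fun y => u y - v y) := contDiff_dcForm huv2 (by norm_num)
  have hA : ContDiff ℝ 1 (ddcForm u) := contDiff_ddcForm hu3 (by norm_num)
  have hB : ContDiff ℝ 1 (ddcForm v) := contDiff_ddcForm hv3 (by norm_num)
  have hdA : ∀ y, extDeriv (ddcForm u) y = 0 := fun y => congrFun (extDeriv_ddcForm hu3) y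
  have hdB : ∀ y, extDeriv (ddcForm v) y = 0 := fun y => congrFun (extDeriv_ddcForm hv3) y
  -- `d(d^c(u - v)) = dd^c u - dd^c v`
  have hdθ : ∀ y, extDeriv (dcForm fun z => u z - v z) y = ddcForm u y - ddcForm v y := by
    intro y
    have h2u : DifferentiableAt ℝ (fderiv ℝ u) y :=
      ((hu2.fderiv_right (m := 1) (by norm_num)).differentiable one_ne_zero) y
    have h2v : DifferentiableAt ℝ (fderiv ℝ v) y :=
      ((hv2.fderiv_right (m := 1) (by norm_num)).differentiable one_ne_zero) y
    have h2uv : DifferentiableAt ℝ (fderiv ℝ fun z => u z - v z) y :=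
      ((huv2.fderiv_right (m := 1) (by norm_num)).differentiable one_ne_zero) y
    ext w
    rw [show extDeriv (dcForm fun z => u z - v z) y = ddcForm (fun z => u z - v z) y from rfl,
      ddcForm_apply h2uv, ContinuousAlternatingMap.sub_apply, ddcForm_apply h2u, ddcForm_apply h2v]
    have hsub : fderiv ℝ (fderiv ℝ fun z => u z - v z) y =
        fderiv ℝ (fderiv ℝ u) y - fderiv ℝ (fderiv ℝ v) y := by
      have h1 : fderiv ℝ (fun z => u z - v z) = fun z => fderiv ℝ u z - fderiv ℝ v z := by
        funext z
        exact fderiv_sub ((hu2.differentiable two_ne_zero) z) ((hv2.differentiable two_ne_zero) z)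
      rw [h1]
      exact fderiv_sub h2u h2v
    simp only [hsub, FunLike.coe_sub, Pi.sub_apply]
    ring
  unfold maPrimitiveFun
  rw [extDeriv_cast, extDeriv_wedge_twoFormGeom hθ hA hB hdA hdB hdθ q x, TwoForm.cast_cast]

/-! ### Smooth cut-offs and function multiples of `Ψ` -/

/-- **Smooth cut-off functions**: for a compact `K` inside an open `U` of a finite-dimensional real
normed space there is `χ ∈ C_c^∞(U)` with `χ = 1` on a neighbourhood of `K` (smooth Urysohn lemma,
Mathlib's `exists_contMDiffMap_zero_one_nhds_of_isClosed` applied to `(K_δ)ᶜ` and `K`). Twin of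
`Literature.Analysis.FluidPDE.Carleman.exists_smooth_cutoff_nhdsSet` (foreign import closure).
[folklore] -/
theorem exists_smooth_cutoff_eq_one_nhdsSet {X : Type*} [NormedAddCommGroup X] [NormedSpace ℝ X]
    [FiniteDimensional ℝ X] {K U : Set X} (hK : IsCompact K) (hU : IsOpen U) (hKU : K ⊆ U) :
    ∃ χ : X → ℝ, ContDiff ℝ ∞ χ ∧ HasCompactSupport χ ∧ tsupport χ ⊆ U ∧
      ∀ᶠ x in 𝓝ˢ K, χ x = 1 := by
  obtain ⟨δ, hδ, hδU⟩ := hK.exists_cthickening_subset_open hU hKU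
  have hd : Disjoint (Metric.thickening δ K)ᶜ K :=
    disjoint_compl_left.mono_right (Metric.self_subset_thickening hδ K)
  obtain ⟨f, hf0, hf1, -⟩ :=
    exists_contMDiffMap_zero_one_nhds_of_isClosed (𝓘(ℝ, X)) (n := (⊤ : ℕ∞))
      Metric.isOpen_thickening.isClosed_compl hK.isClosed hd
  have hsupp : Function.support (f : X → ℝ) ⊆ Metric.thickening δ K := fun x hx => by
    by_contra hx'
    exact hx (hf0.self_of_nhdsSet x hx')
  have htsupp : tsupport (f : X → ℝ) ⊆ Metric.cthickening δ K :=
    (closure_mono hsupp).trans (Metric.closure_thickening_subset_cthickening δ K)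
  exact ⟨f, contMDiff_iff_contDiff.1 f.contMDiff,
    hK.cthickening.of_isClosed_subset (isClosed_tsupport _) htsupp, htsupp.trans hδU, hf1⟩

/-- `alternatizeUncurryFin 0 = 0`. [folklore] -/
theorem alternatizeUncurryFin_zero {k : ℕ} :
    ContinuousAlternatingMap.alternatizeUncurryFin (0 : V →L[ℝ] V [⋀^Fin k]→L[ℝ] ℝ) = 0 :=
  map_zero (ContinuousAlternatingMap.alternatizeUncurryFinCLM ℝ V ℝ)

/-- **Exterior derivative of a function multiple of a form at a point where the function is
critical or the form vanishes**: `d(χ Ψ)(x) = χ(x) dΨ(x)` (the term `dχ ∧ Ψ` drops out).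
[folklore] -/
theorem extDeriv_smul_eq_smul_extDeriv {k : ℕ} {χ : V → ℝ} {Ψ : V → V [⋀^Fin k]→L[ℝ] ℝ} {x : V}
    (hχ : DifferentiableAt ℝ χ x) (hΨ : DifferentiableAt ℝ Ψ x)
    (h0 : fderiv ℝ χ x = 0 ∨ Ψ x = 0) :
    extDeriv (fun y => χ y • Ψ y) x = χ x • extDeriv Ψ x := by
  have hd : HasFDerivAt (fun y => χ y • Ψ y)
      (χ x • fderiv ℝ Ψ x + (fderiv ℝ χ x).smulRight (Ψ x)) x :=
    hχ.hasFDerivAt.smul hΨ.hasFDerivAt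
  simp only [extDeriv]
  rw [hd.fderiv, ContinuousAlternatingMap.alternatizeUncurryFin_add,
    ContinuousAlternatingMap.alternatizeUncurryFin_smul]
  have hz : (fderiv ℝ χ x).smulRight (Ψ x) = 0 := by
    rcases h0 with h | h
    · rw [h]; ext v; simp
    · rw [h]; ext v; simp
  rw [hz, alternatizeUncurryFin_zero, add_zero]

variable (Ω : TopologicalSpace.Opens V)

/-- **The cut-off transgression form `χ Ψ` as a test `(2q+1)`-form on `Ω`**, for smooth `u, v` and
a smooth compactly supported cut-off `χ` with `tsupport χ ⊆ Ω`. [cite: Chirka1989, §15.1] -/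
def maTestForm {χ : V → ℝ} (hχ : ContDiff ℝ ∞ χ) (hχc : HasCompactSupport χ)
    (hχΩ : tsupport χ ⊆ (Ω : Set V)) (hu : ContDiff ℝ ∞ u) (hv : ContDiff ℝ ∞ v) (q : ℕ) :
    TestForm Ω (2 * q + 1) :=
  TestFunction.mk (fun x => χ x • maPrimitiveFun u v q x)
    (hχ.smul (contDiff_maPrimitiveFun hu hv)) hχc.smul_right
    ((tsupport_smul_subset_left _ _).trans hχΩ)

variable {Ω}

/-- The underlying function of `maTestForm`. [folklore] -/
@[simp] theorem coe_maTestForm {χ : V → ℝ} (hχ : ContDiff ℝ ∞ χ) (hχc : HasCompactSupport χ)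
    (hχΩ : tsupport χ ⊆ (Ω : Set V)) (hu : ContDiff ℝ ∞ u) (hv : ContDiff ℝ ∞ v) (q : ℕ) :
    ⇑(maTestForm Ω hχ hχc hχΩ hu hv q) = fun x => χ x • maPrimitiveFun u v q x := rfl

/-- **`d(χΨ)(x) = χ(x) ((dd^c u)^{q+1} - (dd^c v)^{q+1})(x)`** wherever `dχ(x) = 0` or
`d(u - v)(x) = 0`. [cite: Chirka1989, §15.1] -/
theorem extDeriv_maTestForm_of {χ : V → ℝ} (hχ : ContDiff ℝ ∞ χ) (hχc : HasCompactSupport χ)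
    (hχΩ : tsupport χ ⊆ (Ω : Set V)) (hu : ContDiff ℝ ∞ u) (hv : ContDiff ℝ ∞ v) {x : V}
    (h0 : fderiv ℝ χ x = 0 ∨ fderiv ℝ (fun y => u y - v y) x = 0) :
    extDeriv ⇑(maTestForm Ω hχ hχc hχΩ hu hv q) x =
      χ x • TwoForm.cast (by omega) ((ddcForm u x).twoPow (q + 1) - (ddcForm v x).twoPow (q + 1)) := by
  rw [coe_maTestForm, ← extDeriv_maPrimitiveFun hu hv x]
  refine extDeriv_smul_eq_smul_extDeriv (hχ.differentiable (by simp) x)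
    ((contDiff_maPrimitiveFun hu hv).differentiable (by simp) x) ?_
  rcases h0 with h | h
  · exact Or.inl h
  · exact Or.inr (maPrimitiveFun_eq_zero h)

/-! ### Stokes on holomorphic chains -/

variable [FiniteDimensional ℂ V] [MeasurableSpace V] [BorelSpace V]

/-- **Stokes for cut-off Monge–Ampère densities on a holomorphic chain.** For a holomorphic
`(q+1)`-chain `T` on an open `Ω ⊆ V`, smooth `u, v : V → ℝ` and a smooth compactly supported
cut-off `χ` with `tsupport χ ⊆ Ω` such that at every point of the carrier `reg|T|` either
`dχ = 0` or `d(u - v) = 0`: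
`∫_{reg|T|} θ_T · χ · ((dd^c u)^{q+1} - (dd^c v)^{q+1})(ξ_T) d𝓗^{2q+2} = 0` — the pairing of
`[T]` with `d(χΨ)`, `Ψ = d^c(u-v) ∧ R_q` (`[T]` is `d`-closed,
`Harvey1977_boundary_toCurrent_eq_zero_holds`). Typical use: `χ = 1` near the part of the carrier
where `u ≠ v`, e.g. `u = v` off a compact subset of a ball, or off a sub-cylinder of a tube on whose
rim the chain has no points. [cite: Chirka1989, §14.2 Prop. 3 and §15.1] -/
theorem HolomorphicChain.setIntegral_mul_twoPow_ddcForm_sub_eq_zero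
    (T : HolomorphicChain 𝓘(ℂ, V) Ω (q + 1))
    (hu : ContDiff ℝ ∞ u) (hv : ContDiff ℝ ∞ v) {χ : V → ℝ} (hχ : ContDiff ℝ ∞ χ)
    (hχc : HasCompactSupport χ) (hχΩ : tsupport χ ⊆ (Ω : Set V))
    (h0 : ∀ x ∈ T.carrier, fderiv ℝ χ x = 0 ∨ fderiv ℝ (fun y => u y - v y) x = 0) :
    ∫ x in T.carrier, (T.density x : ℝ) * (χ x *
        TwoForm.cast (by omega) ((ddcForm u x).twoPow (q + 1) - (ddcForm v x).twoPow (q + 1))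
          (T.orientationFrame x)) ∂(μHE[2 * q + 1 + 1] : Measure V) = 0 := by
  have h1 : T.boundary (maTestForm Ω hχ hχc hχΩ hu hv q) = 0 := by
    rw [Harvey1977_boundary_toCurrent_eq_zero_holds V Ω q T]
    rfl
  rw [T.boundary_apply_eq_setIntegral] at h1
  rw [← h1]
  refine setIntegral_congr_fun T.measurableSet_carrier fun x hx => ?_
  simp only [extDeriv_maTestForm_of hχ hχc hχΩ hu hv (h0 x hx), ContinuousAlternatingMap.smul_apply,
    smul_eq_mul]

/-- **Stokes for Monge–Ampère densities on a holomorphic chain, compactly supported difference**: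
if `d(u - v)` is compactly supported inside `Ω`, then
`∫_{reg|T|} θ_T · ((dd^c u)^{q+1} - (dd^c v)^{q+1})(ξ_T) d𝓗^{2q+2} = 0` (cut-off `χ = 1` near the
support of `d(u - v)`; off that support the two Monge–Ampère forms agree pointwise).
[cite: Chirka1989, §14.2 Prop. 3 and §15.1] -/
theorem HolomorphicChain.setIntegral_twoPow_ddcForm_sub_eq_zero
    (T : HolomorphicChain 𝓘(ℂ, V) Ω (q + 1))
    (hu : ContDiff ℝ ∞ u) (hv : ContDiff ℝ ∞ v)
    (h : HasCompactSupport (fderiv ℝ (fun y => u y - v y)))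
    (hΩ : tsupport (fderiv ℝ (fun y => u y - v y)) ⊆ (Ω : Set V)) :
    ∫ x in T.carrier, (T.density x : ℝ) *
        TwoForm.cast (by omega) ((ddcForm u x).twoPow (q + 1) - (ddcForm v x).twoPow (q + 1))
          (T.orientationFrame x) ∂(μHE[2 * q + 1 + 1] : Measure V) = 0 := by
  obtain ⟨χ, hχ, hχc, hχΩ, hχ1⟩ := exists_smooth_cutoff_eq_one_nhdsSet h Ω.isOpen hΩ
  have h0 : ∀ x ∈ T.carrier, fderiv ℝ χ x = 0 ∨ fderiv ℝ (fun y => u y - v y) x = 0 := by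
    intro x _
    by_cases hx : x ∈ tsupport (fderiv ℝ (fun y => u y - v y))
    · left
      have hev : χ =ᶠ[𝓝 x] fun _ => 1 := (hχ1.filter_mono (nhds_le_nhdsSet hx))
      rw [hev.fderiv_eq, fderiv_const_apply]
    · exact Or.inr (image_eq_zero_of_notMem_tsupport hx)
  have hmain := T.setIntegral_mul_twoPow_ddcForm_sub_eq_zero hu hv hχ hχc hχΩ h0
  rw [← hmain]
  refine setIntegral_congr_fun T.measurableSet_carrier fun x _ => ?_
  -- where `χ x ≠ 1`, `x ∉ tsupport d(u - v)`, so `u - v` is locally constant and the forms agree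
  by_cases hx : x ∈ tsupport (fderiv ℝ (fun y => u y - v y))
  · rw [hχ1.self_of_nhdsSet x hx, one_mul]
  · have hloc : ∀ᶠ y in 𝓝 x, fderiv ℝ (fun z => u z - v z) y = 0 := by
      have : (tsupport (fderiv ℝ (fun y => u y - v y)))ᶜ ∈ 𝓝 x :=
        (isClosed_tsupport _).isOpen_compl.mem_nhds hx
      filter_upwards [this] with y hy using image_eq_zero_of_notMem_tsupport hy
    have hd : extDeriv (maPrimitiveFun u v q) x = 0 := by
      have hev : maPrimitiveFun u v q =ᶠ[𝓝 x] fun _ => 0 :=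
        hloc.mono fun y hy => maPrimitiveFun_eq_zero hy
      rw [hev.extDeriv_eq]
      simp only [extDeriv, fderiv_const_apply]
      exact alternatizeUncurryFin_zero
    rw [extDeriv_maPrimitiveFun hu hv x] at hd
    rw [hd]
    simp

/-- **Monge–Ampère masses on a holomorphic chain only depend on the weight up to changes whose
differential is compactly supported in `Ω`**: if moreover both densities `θ_T (dd^c u)^{q+1}(ξ_T)`
and `θ_T (dd^c v)^{q+1}(ξ_T)` are integrable on `reg |T|`, then their integrals agree.
[cite: Chirka1989, §15.1] -/
theorem HolomorphicChain.setIntegral_twoPow_ddcForm_eq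
    (T : HolomorphicChain 𝓘(ℂ, V) Ω (q + 1))
    (hu : ContDiff ℝ ∞ u) (hv : ContDiff ℝ ∞ v)
    (h : HasCompactSupport (fderiv ℝ (fun y => u y - v y)))
    (hΩ : tsupport (fderiv ℝ (fun y => u y - v y)) ⊆ (Ω : Set V))
    (hiu : IntegrableOn (fun x => (T.density x : ℝ) *
      TwoForm.cast (by omega) ((ddcForm u x).twoPow (q + 1)) (T.orientationFrame x)) T.carrier
        (μHE[2 * q + 1 + 1] : Measure V))
    (hiv : IntegrableOn (fun x => (T.density x : ℝ) *
      TwoForm.cast (by omega) ((ddcForm v x).twoPow (q + 1)) (T.orientationFrame x)) T.carrier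
        (μHE[2 * q + 1 + 1] : Measure V)) :
    ∫ x in T.carrier, (T.density x : ℝ) *
        TwoForm.cast (by omega) ((ddcForm u x).twoPow (q + 1)) (T.orientationFrame x)
          ∂(μHE[2 * q + 1 + 1] : Measure V) =
      ∫ x in T.carrier, (T.density x : ℝ) *
        TwoForm.cast (by omega) ((ddcForm v x).twoPow (q + 1)) (T.orientationFrame x)
          ∂(μHE[2 * q + 1 + 1] : Measure V) := by
  have h0 := T.setIntegral_twoPow_ddcForm_sub_eq_zero hu hv h hΩ
  have h1 : ∀ x, (T.density x : ℝ) *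
      TwoForm.cast (show 2 * (q + 1) = 2 * q + 1 + 1 by omega)
        ((ddcForm u x).twoPow (q + 1) - (ddcForm v x).twoPow (q + 1)) (T.orientationFrame x) =
      (T.density x : ℝ) * TwoForm.cast (by omega) ((ddcForm u x).twoPow (q + 1)) (T.orientationFrame x) -
      (T.density x : ℝ) * TwoForm.cast (by omega) ((ddcForm v x).twoPow (q + 1)) (T.orientationFrame x) := by
    intro x
    rw [cast_sub, ContinuousAlternatingMap.sub_apply, mul_sub]
  simp_rw [h1] at h0
  rw [integral_sub hiu hiv] at h0
  linarith

/-- **Cut-off version with integrability**: under the hypotheses of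
`setIntegral_mul_twoPow_ddcForm_sub_eq_zero`, if both cut-off densities are integrable on the
carrier then `∫ θ_T χ (dd^c u)^{q+1}(ξ_T) = ∫ θ_T χ (dd^c v)^{q+1}(ξ_T)`. [cite: Chirka1989, §15.1] -/
theorem HolomorphicChain.setIntegral_mul_twoPow_ddcForm_eq
    (T : HolomorphicChain 𝓘(ℂ, V) Ω (q + 1))
    (hu : ContDiff ℝ ∞ u) (hv : ContDiff ℝ ∞ v) {χ : V → ℝ} (hχ : ContDiff ℝ ∞ χ)
    (hχc : HasCompactSupport χ) (hχΩ : tsupport χ ⊆ (Ω : Set V))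
    (h0 : ∀ x ∈ T.carrier, fderiv ℝ χ x = 0 ∨ fderiv ℝ (fun y => u y - v y) x = 0)
    (hiu : IntegrableOn (fun x => (T.density x : ℝ) * (χ x *
      TwoForm.cast (by omega) ((ddcForm u x).twoPow (q + 1)) (T.orientationFrame x))) T.carrier
        (μHE[2 * q + 1 + 1] : Measure V))
    (hiv : IntegrableOn (fun x => (T.density x : ℝ) * (χ x *
      TwoForm.cast (by omega) ((ddcForm v x).twoPow (q + 1)) (T.orientationFrame x))) T.carrier
        (μHE[2 * q + 1 + 1] : Measure V)) :
    ∫ x in T.carrier, (T.density x : ℝ) * (χ x *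
        TwoForm.cast (by omega) ((ddcForm u x).twoPow (q + 1)) (T.orientationFrame x))
          ∂(μHE[2 * q + 1 + 1] : Measure V) =
      ∫ x in T.carrier, (T.density x : ℝ) * (χ x *
        TwoForm.cast (by omega) ((ddcForm v x).twoPow (q + 1)) (T.orientationFrame x))
          ∂(μHE[2 * q + 1 + 1] : Measure V) := by
  have h00 := T.setIntegral_mul_twoPow_ddcForm_sub_eq_zero hu hv hχ hχc hχΩ h0
  have h1 : ∀ x, (T.density x : ℝ) * (χ x *
      TwoForm.cast (show 2 * (q + 1) = 2 * q + 1 + 1 by omega)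
        ((ddcForm u x).twoPow (q + 1) - (ddcForm v x).twoPow (q + 1)) (T.orientationFrame x)) =
      (T.density x : ℝ) * (χ x * TwoForm.cast (by omega) ((ddcForm u x).twoPow (q + 1))
        (T.orientationFrame x)) -
      (T.density x : ℝ) * (χ x * TwoForm.cast (by omega) ((ddcForm v x).twoPow (q + 1))
        (T.orientationFrame x)) := by
    intro x
    rw [cast_sub, ContinuousAlternatingMap.sub_apply, mul_sub, mul_sub]
  simp_rw [h1] at h00
  rw [integral_sub hiu hiv] at h00
  linarith

end Literature.Geometry.Kaehler

end
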